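import Literature.MathematicalPhysics.QuantumLattice.GroundStateSourceBounds
import HarnessLib

/-!
# Sourced Hamiltonians `K − hO`: the two-sided Hellmann–Feynman (Griffiths) bracket on the conjugate
# one-point function from three ENERGY WINDOWS — for every capped state vector and for the tracial ground state

Family `hubbard` / topic `MathematicalPhysics/QuantumLattice`; sequel of `GroundStateSourceBounds.lean`
(tracial source inequalities) written for the pinning-field response programme of the CUPRATE QUESTION
(cell hubbard-cq, LADDER-Hubbard row PC-a; seat hubbard-cq-obsth-3, director row «Hellmann–Feynman bracket →
m_d(h) two-sided node»). MODEL-FREE: `K` ("Hamiltonian") and `O` ("order operator", e.g. `Δ_d + Δ_d†` for the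
`d`-wave pinning field, a staggered magnetisation for a Néel/stripe pinning field) are Hermitian matrices on a
finite nonempty index type, `E₀(h) := Matrix.groundEnergy (K − hO)`, and `N > 0` is a normalisation (the
volume). Concavity of `h ↦ E₀(h)` in its variational form gives, for `h₁ < h < h₂`:

* for EVERY unit vector `ψ` obeying an ENERGY CAP at the source `h`, `Re⟨ψ, (K − hO)ψ⟩ ≤ u·N` (no
  ground-state property needed — this is the hypothesis a relaxation row "energy ≤ u" speaks about), and
  LOWER bounds `ℓ₁ N ≤ E₀(h₁)`, `ℓ₂ N ≤ E₀(h₂)`: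
  `(ℓ₁ − u)/(h − h₁) ≤ Re⟨ψ, Oψ⟩/N ≤ (u − ℓ₂)/(h₂ − h)`
  (`re_rayleigh_div_ge_of_cap_of_lower`, `re_rayleigh_div_le_of_cap_of_lower`, `re_rayleigh_div_mem_Icc`);
  the variational principle `E₀(h') ≤ Re⟨ψ,(K − h'O)ψ⟩ = Re⟨ψ,(K − hO)ψ⟩ − (h' − h) Re⟨ψ,Oψ⟩`
  (`Matrix.groundEnergy_le_rayleigh_holds`, `re_rayleigh_source_eq`) at `h' = h₁, h₂`;
* the same for the TRACIAL ground state `ω_{K−hO}` of `GroundStateSourceBounds.lean` with the cap replaced by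
  an upper window `E₀(h) ≤ u·N` (`re_groundStateFunctional_div_ge_of_window`, `…_le_of_window`, `…_mem_Icc`).

These are the finite-volume NODES a certified pinning-field menu feeds: `ℓ₁, ℓ₂` from sourced SDP window
certificates (valid on all large tori), `u` from any variational state of the SOURCED problem at `h`; the
`d`-wave torus instance (`dWaveSourceTorus`, with `Re ω(Δ_d + Δ_d†) = 2L²·dWaveSourceDensity`) and its
thermodynamic-limit stair are in `Summits/Ventures/CertifiedManyBodySolver/Observables/SourcedOrderParameterFloor.lean`.
All statements are folklore (R. B. Griffiths, Phys. Rev. 152 (1966) 240, §II: one-sided derivatives of a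
concave ground energy bound the conjugate expectation in every ground state; T. Koma, H. Tasaki, J. Stat.
Phys. 76 (1994) 745, §1); no definition, no named fact, no `sorry`. Tree search: `lean search
"rayleigh_source|re_rayleigh_div|groundStateFunctional_div"` — nothing; `GroundStateSourceBounds` has the
tracial `(h' − h)·Re ω_h(O) ≤ E₀(h) − E₀(h')` only (REUSED here), `FinDimSpectrumProofs` the variational
principle (REUSED).
-/

noncomputable section

namespace Literature.MathematicalPhysics.QuantumLattice

open Matrix
open scoped ComplexOrder

/-! ### The Rayleigh quotient is affine in the source -/

section Affine

variable {n : Type*} [Fintype n]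

/-- `Re⟨ψ, (K − h'O)ψ⟩ = Re⟨ψ, (K − hO)ψ⟩ − (h' − h)·Re⟨ψ, Oψ⟩` (the expectation is affine in the source —
the starting point of Griffiths' argument). [cite: Griffiths1966, §II] -/
theorem re_rayleigh_source_eq (K O : Matrix n n ℂ) (ψ : n → ℂ) (h h' : ℝ) :
    (star ψ ⬝ᵥ (K - (h' : ℂ) • O) *ᵥ ψ).re =
      (star ψ ⬝ᵥ (K - (h : ℂ) • O) *ᵥ ψ).re - (h' - h) * (star ψ ⬝ᵥ O *ᵥ ψ).re := by
  simp only [sub_mulVec, smul_mulVec, dotProduct_sub, dotProduct_smul, Complex.sub_re, smul_eq_mul,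
    Complex.re_ofReal_mul]
  ring

/-- An eigenvector equation gives the Rayleigh value: `Aψ = E·ψ`, `‖ψ‖ = 1` ⇒ `Re⟨ψ, Aψ⟩ = E` (so ground-state
vectors attain `E₀`, Tasaki (2020) §2.1, (2.1.6)). [cite: Tasaki2020, §2.1] -/
theorem re_rayleigh_of_eigenvector {A : Matrix n n ℂ} {ψ : n → ℂ} (hψ : star ψ ⬝ᵥ ψ = 1) {E : ℝ}
    (hE : A *ᵥ ψ = (E : ℂ) • ψ) : (star ψ ⬝ᵥ A *ᵥ ψ).re = E := by
  rw [hE, dotProduct_smul, hψ, smul_eq_mul, mul_one, Complex.ofReal_re]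

end Affine

/-! ### Every capped state vector: the bracket from a cap at `h` and lower bounds at `h₁ < h < h₂` -/

section Vector

variable {n : Type*} [Fintype n] [DecidableEq n]

/-- **Griffiths inequality, vector form**: for Hermitian `K, O`, a unit vector `ψ` and sources `h, h'`,
`E₀(K − h'O) ≤ Re⟨ψ,(K − hO)ψ⟩ − (h' − h)·Re⟨ψ, Oψ⟩` (the variational principle at `h'` with trial state
`ψ`). [cite: Griffiths1966, §II] -/
theorem groundEnergy_source_le_re_rayleigh_sub {K O : Matrix n n ℂ} (hK : K.IsHermitian) (hO : O.IsHermitian)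
    {ψ : n → ℂ} (hψ : star ψ ⬝ᵥ ψ = 1) (h h' : ℝ) :
    (K - (h' : ℂ) • O).groundEnergy ≤
      (star ψ ⬝ᵥ (K - (h : ℂ) • O) *ᵥ ψ).re - (h' - h) * (star ψ ⬝ᵥ O *ᵥ ψ).re := by
  rw [← re_rayleigh_source_eq K O ψ h h']
  exact Matrix.groundEnergy_le_rayleigh_holds (isHermitian_sub_real_smul hK hO h') ψ hψ

/-- **FLOOR for every capped state**: `h₁ < h`, a lower bound `ℓ N ≤ E₀(K − h₁O)` at the smaller source and an
energy CAP `Re⟨ψ,(K − hO)ψ⟩ ≤ u N` on the unit vector `ψ` give `(ℓ − u)/(h − h₁) ≤ Re⟨ψ, Oψ⟩/N`.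
[cite: Griffiths1966, §II] -/
theorem re_rayleigh_div_ge_of_cap_of_lower {K O : Matrix n n ℂ} (hK : K.IsHermitian) (hO : O.IsHermitian)
    {ψ : n → ℂ} (hψ : star ψ ⬝ᵥ ψ = 1) {N : ℝ} (hN : 0 < N) {h₁ h u ℓ : ℝ} (hlt : h₁ < h)
    (hl : ℓ * N ≤ (K - (h₁ : ℂ) • O).groundEnergy)
    (hu : (star ψ ⬝ᵥ (K - (h : ℂ) • O) *ᵥ ψ).re ≤ u * N) :
    (ℓ - u) / (h - h₁) ≤ (star ψ ⬝ᵥ O *ᵥ ψ).re / N := by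
  have key := groundEnergy_source_le_re_rayleigh_sub hK hO hψ h h₁
  have hδ : 0 < h - h₁ := sub_pos.2 hlt
  rw [div_le_div_iff₀ hδ hN]
  nlinarith [key, hl, hu]

/-- **CEILING for every capped state**: `h < h₂`, an energy CAP `Re⟨ψ,(K − hO)ψ⟩ ≤ u N` and a lower bound
`ℓ N ≤ E₀(K − h₂O)` at the larger source give `Re⟨ψ, Oψ⟩/N ≤ (u − ℓ)/(h₂ − h)`. [cite: Griffiths1966, §II] -/
theorem re_rayleigh_div_le_of_cap_of_lower {K O : Matrix n n ℂ} (hK : K.IsHermitian) (hO : O.IsHermitian)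
    {ψ : n → ℂ} (hψ : star ψ ⬝ᵥ ψ = 1) {N : ℝ} (hN : 0 < N) {h h₂ u ℓ : ℝ} (hlt : h < h₂)
    (hu : (star ψ ⬝ᵥ (K - (h : ℂ) • O) *ᵥ ψ).re ≤ u * N)
    (hl : ℓ * N ≤ (K - (h₂ : ℂ) • O).groundEnergy) :
    (star ψ ⬝ᵥ O *ᵥ ψ).re / N ≤ (u - ℓ) / (h₂ - h) := by
  have key := groundEnergy_source_le_re_rayleigh_sub hK hO hψ h h₂
  have hδ : 0 < h₂ - h := sub_pos.2 hlt
  rw [div_le_div_iff₀ hN hδ]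
  nlinarith [key, hl, hu]

/-- **The two-sided node for every capped state**: `h₁ < h < h₂`, lower bounds `ℓ₁ N ≤ E₀(K − h₁O)`,
`ℓ₂ N ≤ E₀(K − h₂O)` and a cap `Re⟨ψ,(K − hO)ψ⟩ ≤ u N` give
`Re⟨ψ, Oψ⟩/N ∈ [(ℓ₁ − u)/(h − h₁), (u − ℓ₂)/(h₂ − h)]`. In particular this holds for every GROUND STATE
vector of `K − hO` as soon as `E₀(K − hO) ≤ u N` (`re_rayleigh_div_mem_Icc_of_ground`). [cite: Griffiths1966, §II] -/
theorem re_rayleigh_div_mem_Icc {K O : Matrix n n ℂ} (hK : K.IsHermitian) (hO : O.IsHermitian)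
    {ψ : n → ℂ} (hψ : star ψ ⬝ᵥ ψ = 1) {N : ℝ} (hN : 0 < N) {h₁ h h₂ u ℓ₁ ℓ₂ : ℝ}
    (hlo : h₁ < h) (hhi : h < h₂)
    (hl1 : ℓ₁ * N ≤ (K - (h₁ : ℂ) • O).groundEnergy)
    (hu : (star ψ ⬝ᵥ (K - (h : ℂ) • O) *ᵥ ψ).re ≤ u * N)
    (hl2 : ℓ₂ * N ≤ (K - (h₂ : ℂ) • O).groundEnergy) :
    (star ψ ⬝ᵥ O *ᵥ ψ).re / N ∈ Set.Icc ((ℓ₁ - u) / (h - h₁)) ((u - ℓ₂) / (h₂ - h)) :=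
  ⟨re_rayleigh_div_ge_of_cap_of_lower hK hO hψ hN hlo hl1 hu,
    re_rayleigh_div_le_of_cap_of_lower hK hO hψ hN hhi hu hl2⟩

/-- Ground-state vectors satisfy the cap given an upper WINDOW `E₀(K − hO) ≤ u N`: if
`Re⟨ψ,(K − hO)ψ⟩ = E₀(K − hO)` (e.g. `(K − hO)ψ = E₀ψ`), the two-sided node holds for `ψ`. [cite: Griffiths1966, §II] -/
theorem re_rayleigh_div_mem_Icc_of_ground {K O : Matrix n n ℂ} (hK : K.IsHermitian) (hO : O.IsHermitian)
    {ψ : n → ℂ} (hψ : star ψ ⬝ᵥ ψ = 1) {N : ℝ} (hN : 0 < N) {h₁ h h₂ u ℓ₁ ℓ₂ : ℝ}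
    (hlo : h₁ < h) (hhi : h < h₂)
    (hground : (star ψ ⬝ᵥ (K - (h : ℂ) • O) *ᵥ ψ).re = (K - (h : ℂ) • O).groundEnergy)
    (hl1 : ℓ₁ * N ≤ (K - (h₁ : ℂ) • O).groundEnergy)
    (hu : (K - (h : ℂ) • O).groundEnergy ≤ u * N)
    (hl2 : ℓ₂ * N ≤ (K - (h₂ : ℂ) • O).groundEnergy) :
    (star ψ ⬝ᵥ O *ᵥ ψ).re / N ∈ Set.Icc ((ℓ₁ - u) / (h - h₁)) ((u - ℓ₂) / (h₂ - h)) :=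
  re_rayleigh_div_mem_Icc hK hO hψ hN hlo hhi hl1 (hground.le.trans hu) hl2

/-- Slack form (NEAR-ground states, the shape of a relaxation's energy row with explicit slack): if
`Re⟨ψ,(K − hO)ψ⟩ ≤ E₀(K − hO) + s` then for `h₁ < h < h₂`
`(E₀(h₁) − E₀(h) − s)/(h − h₁) ≤ Re⟨ψ, Oψ⟩ ≤ (E₀(h) + s − E₀(h₂))/(h₂ − h)`. [cite: Griffiths1966, §II] -/
theorem re_rayleigh_mem_Icc_of_slack {K O : Matrix n n ℂ} (hK : K.IsHermitian) (hO : O.IsHermitian)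
    {ψ : n → ℂ} (hψ : star ψ ⬝ᵥ ψ = 1) {h₁ h h₂ s : ℝ} (hlo : h₁ < h) (hhi : h < h₂)
    (hs : (star ψ ⬝ᵥ (K - (h : ℂ) • O) *ᵥ ψ).re ≤ (K - (h : ℂ) • O).groundEnergy + s) :
    (star ψ ⬝ᵥ O *ᵥ ψ).re ∈
      Set.Icc (((K - (h₁ : ℂ) • O).groundEnergy - (K - (h : ℂ) • O).groundEnergy - s) / (h - h₁))
        (((K - (h : ℂ) • O).groundEnergy + s - (K - (h₂ : ℂ) • O).groundEnergy) / (h₂ - h)) := by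
  have k1 := groundEnergy_source_le_re_rayleigh_sub hK hO hψ h h₁
  have k2 := groundEnergy_source_le_re_rayleigh_sub hK hO hψ h h₂
  have hδ1 : 0 < h - h₁ := sub_pos.2 hlo
  have hδ2 : 0 < h₂ - h := sub_pos.2 hhi
  constructor
  · rw [div_le_iff₀ hδ1]
    nlinarith [k1, hs]
  · rw [le_div_iff₀ hδ2]
    nlinarith [k2, hs]

end Vector

/-! ### The tracial ground state: the bracket from three windows -/

section Tracial

variable {n : Type*} [Fintype n] [DecidableEq n] [Nonempty n]

/-- **FLOOR, tracial ground state**: `h₁ < h`, `ℓ N ≤ E₀(K − h₁O)` and `E₀(K − hO) ≤ u N` give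
`(ℓ − u)/(h − h₁) ≤ Re ω_{K−hO}(O)/N`. [cite: KomaTasaki1994, §1] -/
theorem re_groundStateFunctional_div_ge_of_window {K O : Matrix n n ℂ} (hK : K.IsHermitian)
    (hO : O.IsHermitian) {N : ℝ} (hN : 0 < N) {h₁ h u ℓ : ℝ} (hlt : h₁ < h)
    (hl : ℓ * N ≤ (K - (h₁ : ℂ) • O).groundEnergy) (hu : (K - (h : ℂ) • O).groundEnergy ≤ u * N) :
    (ℓ - u) / (h - h₁) ≤ ((K - (h : ℂ) • O).groundStateFunctional O).re / N := by
  have key := sub_mul_re_groundStateFunctional_le hK hO h h₁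
  have hδ : 0 < h - h₁ := sub_pos.2 hlt
  rw [div_le_div_iff₀ hδ hN]
  nlinarith [key, hl, hu]

/-- **CEILING, tracial ground state**: `h < h₂`, `E₀(K − hO) ≤ u N` and `ℓ N ≤ E₀(K − h₂O)` give
`Re ω_{K−hO}(O)/N ≤ (u − ℓ)/(h₂ − h)`. [cite: KomaTasaki1994, §1] -/
theorem re_groundStateFunctional_div_le_of_window {K O : Matrix n n ℂ} (hK : K.IsHermitian)
    (hO : O.IsHermitian) {N : ℝ} (hN : 0 < N) {h h₂ u ℓ : ℝ} (hlt : h < h₂)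
    (hu : (K - (h : ℂ) • O).groundEnergy ≤ u * N) (hl : ℓ * N ≤ (K - (h₂ : ℂ) • O).groundEnergy) :
    ((K - (h : ℂ) • O).groundStateFunctional O).re / N ≤ (u - ℓ) / (h₂ - h) := by
  have key := sub_mul_re_groundStateFunctional_le hK hO h h₂
  have hδ : 0 < h₂ - h := sub_pos.2 hlt
  rw [div_le_div_iff₀ hN hδ]
  nlinarith [key, hl, hu]

/-- **The two-sided node, tracial ground state**: `h₁ < h < h₂` and the three windows
`ℓ₁ N ≤ E₀(K − h₁O)`, `E₀(K − hO) ≤ u N`, `ℓ₂ N ≤ E₀(K − h₂O)` give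
`Re ω_{K−hO}(O)/N ∈ [(ℓ₁ − u)/(h − h₁), (u − ℓ₂)/(h₂ − h)]`. [cite: KomaTasaki1994, §1] -/
theorem re_groundStateFunctional_div_mem_Icc {K O : Matrix n n ℂ} (hK : K.IsHermitian)
    (hO : O.IsHermitian) {N : ℝ} (hN : 0 < N) {h₁ h h₂ u ℓ₁ ℓ₂ : ℝ} (hlo : h₁ < h) (hhi : h < h₂)
    (hl1 : ℓ₁ * N ≤ (K - (h₁ : ℂ) • O).groundEnergy) (hu : (K - (h : ℂ) • O).groundEnergy ≤ u * N)
    (hl2 : ℓ₂ * N ≤ (K - (h₂ : ℂ) • O).groundEnergy) :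
    ((K - (h : ℂ) • O).groundStateFunctional O).re / N ∈
      Set.Icc ((ℓ₁ - u) / (h - h₁)) ((u - ℓ₂) / (h₂ - h)) :=
  ⟨re_groundStateFunctional_div_ge_of_window hK hO hN hlo hl1 hu,
    re_groundStateFunctional_div_le_of_window hK hO hN hhi hu hl2⟩

/-- Without windows: the exact bracket of the tracial one-point function by the sourced ground energies,
`(E₀(h₁) − E₀(h))/(h − h₁) ≤ Re ω_{K−hO}(O) ≤ (E₀(h) − E₀(h₂))/(h₂ − h)` for `h₁ < h < h₂` (both chords
of the concave `h ↦ E₀(K − hO)` bracket its supergradient `−Re ω_h(O)`). [cite: KomaTasaki1994, §1] -/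
theorem re_groundStateFunctional_mem_Icc_chords {K O : Matrix n n ℂ} (hK : K.IsHermitian)
    (hO : O.IsHermitian) {h₁ h h₂ : ℝ} (hlo : h₁ < h) (hhi : h < h₂) :
    ((K - (h : ℂ) • O).groundStateFunctional O).re ∈
      Set.Icc (((K - (h₁ : ℂ) • O).groundEnergy - (K - (h : ℂ) • O).groundEnergy) / (h - h₁))
        (((K - (h : ℂ) • O).groundEnergy - (K - (h₂ : ℂ) • O).groundEnergy) / (h₂ - h)) := by
  have k1 := sub_mul_re_groundStateFunctional_le hK hO h h₁
  have k2 := sub_mul_re_groundStateFunctional_le hK hO h h₂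
  have hδ1 : 0 < h - h₁ := sub_pos.2 hlo
  have hδ2 : 0 < h₂ - h := sub_pos.2 hhi
  constructor
  · rw [div_le_iff₀ hδ1]
    nlinarith [k1]
  · rw [le_div_iff₀ hδ2]
    nlinarith [k2]

end Tracial

end Literature.MathematicalPhysics.QuantumLattice

end
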